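import Literature.AlgebraicGeometry.Resolution.RegularHomReduced
import Literature.AlgebraicGeometry.Resolution.PthRootDerivationRegular
import Mathlib.RingTheory.AdicCompletion.Algebra
import Mathlib.Algebra.CharP.Subring
import HarnessLib

/-!
# Crux `Steer` (stmt-ResolutionOfSingularities-16345), chain W4.1, R2 σ_top line: **K(1), core** —
# no eternal Frobenius-divisibility chain with isolated torsor over an excellent local domain (Theses-free)

OURS (campaign `res-hironaka`, rung L ★L-G4, slot W4.1, chain W4.1, seat `res-L0-w41-stub-7` = `res-D-pv-011`;
replaces the role of no printed item; NOT a statement of the manuscript under review; AI review is weaker than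
expert review). This file and its sequel `FrobeniusClosingSteerNoEternalChainOne.lean` PROVE the support piece
**K(1) = `∀ p prime, NoEternalIsolatedRadicandChain p 1`** of the planner's typed sub-plan `L/w41/Sketch-R2-steered.lean` (res-L0-w41-plan-1 g5, sha16 fb4f9514a6cb98fe, §3.1 —
idea-1's `NoEternalIsolatedRadicandChain` VERBATIM, the case `c = 1`; card `L/w41/CRUX-PLAN-Steer-v3-R2.md`, row K(1)
«excellent DVR: eternal `x^p`-divisibility mod `p`-th powers ⇒ `f ∈ Ŝ^p ∩ S = S^p` (excellence) ⇒ torsor non-reduced ⇒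
not isolated»), with the vocabulary (`HasIsolatedSingularity`, `RadicandRing`, `IsQuadraticTransform`,
`IsExcellentRing`) read through; THIS file is the single-ring core `NoEternalChainOne.false_of_frobeniusChain`, the sequel assembles the
verbatim statement (by-name leaf `fun p hp => NoEternalChainOne.noEternalIsolatedRadicandChain_one p hp`).

## Proof (ours; no completion element `û` and no `S ∩ Ŝ^p = S^p` lemma is needed as such)

Single-ring core `NoEternalChainOne.false_of_frobeniusChain`: `S` an excellent Noetherian local DOMAIN of
characteristic `p` which is not a field, `f g x : ℕ → S` with `x n ∈ 𝔪`, `f (n+1) · (x n)^p = f n − (g n)^p`, and the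
torsor germ `S' := S[T]/(T^p − f 0)` with ISOLATED singularity (every non-maximal prime has a regular local ring).
* telescoping in characteristic `p`: `f 0 − (c n)^p = (a n)^p · f n` with `a n = x 0 ⋯ x (n−1) ∈ 𝔪^n`,
  `c n = Σ_{j<n} a j · g j`, so `c (n+1) − c n ∈ 𝔪^n` and `f 0 − (c n)^p ∈ 𝔪^n`;
* `S'` is local (`isLocalRing_adjoinRoot_X_pow_sub_C_of_charP`), free of rank `p` over `S`, Noetherian, integral over
  `S`; its maximal ideal `𝔪'` satisfies `𝔪'^k ⊆ 𝔪S'` for some `k` (every prime over `𝔪S'` is `𝔪'`);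
* if `S'` is REDUCED: `S'` is excellent (`IsExcellentRing.of_finiteType'`), so its `𝔪'`-adic completion is reduced
  (`IsExcellentRing.isReduced_adicCompletion`, Stacks 07QK/07QV); but the `𝔪'`-adic Cauchy sequence `T − c n` defines
  an element `z` of the completion with `z^p = 0` (`(T − c n)^p = f 0 − (c n)^p ∈ 𝔪^n S'`) and `z ≠ 0` (the
  `T`-coordinate of `T − c k` is `1 ∉ 𝔪`, while `𝔪'^k ⊆ 𝔪 S'`) — contradiction;
* if `S'` is NOT reduced: a non-zero nilpotent `w` has `Ann(w) ⊆ P` for a prime `P ≠ 𝔪'` (else `𝔪' ⊆ √Ann(w)` and a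
  non-zero `y ∈ 𝔪` would kill `w`, but `S'` is torsion-free over the domain `S`), and `S'_P` is then not reduced, hence
  not regular — contradicting isolatedness at the non-maximal prime `P < 𝔪'`.
Assembly `noEternalIsolatedRadicandChain_one`: in codimension one the members `S m` are regular local of dimension one
(discrete valuation rings), and a quadratic transform of a local subring with principal maximal ideal is the ring
itself (`NoEternalChainOne.eq_of_isQuadraticTransform_of_span_singleton`: `x = π r` forces `r` to be a unit by
domination, so `R[𝔪/x] = R` and `R₁ = R`); hence the whole chain lives in `S 0`, `x m ∈ 𝔪_{S 0}`, and the core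
applies at stage `0`. [cite: StacksProject, Tag 07QK] [cite: Matsumura1987, §32 p. 260] [cite: Cutkosky2014, §2.1]
[folklore]
-/

noncomputable section

-- `Summit.<S>.<S>.…` duplicates the summit name by design (single-problem summit).
set_option linter.dupNamespace false

open Polynomial IsLocalRing

namespace Summit.ResolutionOfSingularities.ResolutionOfSingularities.Theorems.SwitchingDichotomy

open Literature.AlgebraicGeometry.Resolution

namespace NoEternalChainOne

universe u

/-! ## (1) The torsor germ `S' = S[T]/(T^p − f)` over a local ring of characteristic `p` -/

section Radicand

variable {S : Type u} [CommRing S] (p : ℕ) [hp : Fact p.Prime] (f : S)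

/-- `T^p − f` is monic. [folklore] -/
theorem monic_X_pow_sub_C' : ((X : S[X]) ^ p - C f).Monic := monic_X_pow_sub_C f hp.out.ne_zero

omit hp in
/-- In `S[T]/(T^p − f)`, `T^p = f`. [folklore] -/
theorem root_pow_eq : AdjoinRoot.root ((X : S[X]) ^ p - C f) ^ p = AdjoinRoot.of _ f := by
  have := AdjoinRoot.eval₂_root ((X : S[X]) ^ p - C f)
  rwa [eval₂_sub, eval₂_X_pow, eval₂_C, sub_eq_zero] at this

/-- **The `T`-coordinate**: an `S`-linear functional `λ` on `S' = S[T]/(T^p − f)` (`p ≥ 2`) with `λ(T) = 1`,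
`λ(S) = 0`, namely the coordinate of `T` in the power basis `1, T, …, T^{p−1}`. [folklore] -/
theorem exists_coord_root [Nontrivial S] :
    ∃ lam : AdjoinRoot ((X : S[X]) ^ p - C f) →ₗ[S] S, lam (AdjoinRoot.root _) = 1 ∧
      ∀ c : S, lam (AdjoinRoot.of _ c) = 0 := by
  classical
  set g : S[X] := (X : S[X]) ^ p - C f with hg
  have hmon : g.Monic := monic_X_pow_sub_C' p f
  let pb := AdjoinRoot.powerBasis' hmon
  have hdim : pb.dim = p := by
    show g.natDegree = p
    rw [hg, natDegree_X_pow_sub_C]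
  have h1 : 1 < pb.dim := by rw [hdim]; exact hp.out.one_lt
  have h0 : 0 < pb.dim := lt_trans zero_lt_one h1
  let i₁ : Fin pb.dim := ⟨1, h1⟩
  let i₀ : Fin pb.dim := ⟨0, h0⟩
  have hb1 : pb.basis i₁ = AdjoinRoot.root g := by
    rw [PowerBasis.coe_basis]; show pb.gen ^ 1 = _; rw [pow_one]; rfl
  have hb0 : pb.basis i₀ = 1 := by
    rw [PowerBasis.coe_basis]; show pb.gen ^ 0 = _; rw [pow_zero]
  refine ⟨pb.basis.coord i₁, ?_, fun c => ?_⟩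
  · rw [← hb1, Module.Basis.coord_apply, Module.Basis.repr_self, Finsupp.single_eq_same]
  · have : AdjoinRoot.of g c = c • pb.basis i₀ := by
      rw [hb0, Algebra.smul_def, mul_one]; rfl
    rw [this, map_smul, Module.Basis.coord_apply, Module.Basis.repr_self, Finsupp.single_eq_of_ne]
    · exact smul_zero c
    · intro h
      have := congrArg Fin.val h
      simp [i₀, i₁] at this

variable [IsLocalRing S] [CharP S p]

/-- The extension `𝔪S'` of the maximal ideal of `S` is a proper ideal of `S'` (`S'` is integral over `S`, so a
maximal ideal of `S'` lies over `𝔪`). [folklore] -/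
theorem map_maximalIdeal_ne_top :
    (maximalIdeal S).map (algebraMap S (AdjoinRoot ((X : S[X]) ^ p - C f))) ≠ ⊤ := by
  set g : S[X] := (X : S[X]) ^ p - C f with hg
  haveI := isLocalRing_adjoinRoot_X_pow_sub_C_of_charP p f
  have hmon : g.Monic := monic_X_pow_sub_C' p f
  haveI : Module.Finite S (AdjoinRoot g) := hmon.finite_adjoinRoot
  haveI : Algebra.IsIntegral S (AdjoinRoot g) := inferInstance
  have hker : RingHom.ker (algebraMap S (AdjoinRoot g)) ≤ maximalIdeal S :=
    IsLocalRing.le_maximalIdeal (RingHom.ker_ne_top _)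
  obtain ⟨Q, hQ, hQc⟩ := Ideal.exists_ideal_over_maximal_of_isIntegral (S := AdjoinRoot g) (maximalIdeal S) hker
  intro htop
  have : (maximalIdeal S).map (algebraMap S (AdjoinRoot g)) ≤ Q := Ideal.map_le_iff_le_comap.mpr hQc.ge
  rw [htop, top_le_iff] at this
  exact hQ.ne_top this

/-- `𝔪S' ⊆ 𝔪'`. [folklore] -/
theorem map_maximalIdeal_le :
    haveI := isLocalRing_adjoinRoot_X_pow_sub_C_of_charP p f
    (maximalIdeal S).map (algebraMap S (AdjoinRoot ((X : S[X]) ^ p - C f))) ≤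
      maximalIdeal (AdjoinRoot ((X : S[X]) ^ p - C f)) :=
  haveI := isLocalRing_adjoinRoot_X_pow_sub_C_of_charP p f
  IsLocalRing.le_maximalIdeal (map_maximalIdeal_ne_top p f)

/-- **Some power of `𝔪'` lies in `𝔪S'`** (`S` Noetherian): every prime of `S'` over `𝔪S'` lies over `𝔪`, hence is
maximal (integrality), hence is `𝔪'`; so `𝔪' ⊆ √(𝔪S')`. [folklore] -/
theorem exists_pow_maximalIdeal_le [IsNoetherianRing S] :
    haveI := isLocalRing_adjoinRoot_X_pow_sub_C_of_charP p f
    ∃ k : ℕ, maximalIdeal (AdjoinRoot ((X : S[X]) ^ p - C f)) ^ k ≤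
      (maximalIdeal S).map (algebraMap S (AdjoinRoot ((X : S[X]) ^ p - C f))) := by
  set g : S[X] := (X : S[X]) ^ p - C f with hg
  haveI := isLocalRing_adjoinRoot_X_pow_sub_C_of_charP p f
  have hmon : g.Monic := monic_X_pow_sub_C' p f
  haveI : Module.Finite S (AdjoinRoot g) := hmon.finite_adjoinRoot
  haveI : Algebra.IsIntegral S (AdjoinRoot g) := inferInstance
  haveI : IsNoetherianRing (AdjoinRoot g) :=
    inferInstanceAs (IsNoetherianRing (S[X] ⧸ Ideal.span {g}))
  set J : Ideal (AdjoinRoot g) := (maximalIdeal S).map (algebraMap S (AdjoinRoot g)) with hJ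
  have hrad : maximalIdeal (AdjoinRoot g) ≤ J.radical := by
    rw [Ideal.radical_eq_sInf]
    refine le_sInf ?_
    rintro Q ⟨hJQ, hQ⟩
    haveI := hQ
    have hc : Q.comap (algebraMap S (AdjoinRoot g)) = maximalIdeal S := by
      refine ((maximalIdeal.isMaximal S).eq_of_le (Ideal.comap_ne_top _ hQ.ne_top) ?_).symm
      exact Ideal.map_le_iff_le_comap.mp hJQ
    have hQmax : Q.IsMaximal :=
      Ideal.isMaximal_of_isIntegral_of_isMaximal_comap (R := S) Q (hc ▸ maximalIdeal.isMaximal S)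
    exact (IsLocalRing.eq_maximalIdeal hQmax).ge
  exact Ideal.exists_pow_le_of_le_radical_of_fg hrad (IsNoetherian.noetherian _)

end Radicand

/-! ## (2) The single-ring core: an eternal Frobenius-divisibility chain with isolated torsor is impossible over an
excellent local domain of characteristic `p` -/

section Core

variable {S : Type u} [CommRing S] (p : ℕ) [hp : Fact p.Prime] [CharP S p]

/-- **Telescoping in characteristic `p`.** From `f (n+1) · (x n)^p = f n − (g n)^p` with `x n ∈ 𝔪`: the partial sums
`c n = Σ_{j<n} (x 0 ⋯ x (j−1)) · g j` satisfy `c (n+1) − c n ∈ 𝔪^n` and `f 0 − (c n)^p = (x 0 ⋯ x (n−1))^p · f n ∈ 𝔪^n`.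
[folklore] -/
theorem exists_frobenius_approx [IsLocalRing S] (f g x : ℕ → S) (hx : ∀ n, x n ∈ maximalIdeal S)
    (hrel : ∀ n, f (n + 1) * x n ^ p = f n - g n ^ p) :
    ∃ c : ℕ → S, (∀ n, c (n + 1) - c n ∈ maximalIdeal S ^ n) ∧ ∀ n, f 0 - c n ^ p ∈ maximalIdeal S ^ n := by
  let a : ℕ → S := fun n => ∏ j ∈ Finset.range n, x j
  let c : ℕ → S := fun n => ∑ j ∈ Finset.range n, a j * g j
  have ha : ∀ n, a n ∈ maximalIdeal S ^ n := by
    intro n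
    induction n with
    | zero => simp [a]
    | succ n ih =>
      show (∏ j ∈ Finset.range (n + 1), x j) ∈ _
      rw [Finset.prod_range_succ, pow_succ]
      exact Ideal.mul_mem_mul ih (hx n)
  have hc : ∀ n, c (n + 1) = c n + a n * g n := fun n => Finset.sum_range_succ _ _
  have key : ∀ n, f 0 - c n ^ p = a n ^ p * f n := by
    intro n
    induction n with
    | zero => simp [a, c, zero_pow hp.out.ne_zero]
    | succ n ih =>
      have han : a (n + 1) = a n * x n := Finset.prod_range_succ _ _
      rw [hc, add_pow_char, ← sub_sub, ih, mul_pow, ← mul_sub, ← hrel n, han, mul_pow]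
      ring
  refine ⟨c, fun n => ?_, fun n => ?_⟩
  · rw [hc, add_sub_cancel_left]
    exact Ideal.mul_mem_right _ _ (ha n)
  · rw [key]
    exact Ideal.mul_mem_right _ _ (Ideal.pow_mem_of_mem _ (ha n) p hp.out.pos)

variable [IsDomain S] [IsLocalRing S] [IsNoetherianRing S]

/-- **The single-ring core of K(1).** Over an excellent Noetherian local DOMAIN `S` of characteristic `p` which is
not a field, there is no sequence `f (n+1) · (x n)^p = f n − (g n)^p` (`x n ∈ 𝔪`, all `n`) whose initial torsor germ
`S[T]/(T^p − f 0)` has an ISOLATED singularity (all non-maximal primes regular). See the file header for the proof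
(reduced case: the completion of the excellent reduced local ring `S'` would contain the non-zero nilpotent
`lim (T − c n)`; non-reduced case: a non-zero nilpotent survives in `S'_P` at a non-maximal prime `P ⊇ Ann`).
[cite: StacksProject, Tag 07QK] [cite: Matsumura1987, §32 p. 260] [folklore] -/
theorem false_of_frobeniusChain (hS : maximalIdeal S ≠ ⊥) (hexc : IsExcellentRing S)
    (f g x : ℕ → S) (hx : ∀ n, x n ∈ maximalIdeal S) (hrel : ∀ n, f (n + 1) * x n ^ p = f n - g n ^ p)
    (hisol : ∀ (P : Ideal (AdjoinRoot ((X : S[X]) ^ p - C (f 0)))) [P.IsPrime],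
      (∃ Q : Ideal (AdjoinRoot ((X : S[X]) ^ p - C (f 0))), Q.IsPrime ∧ P < Q) →
      IsRegularLocalRing (Localization.AtPrime P)) : False := by
  classical
  set F : S[X] := (X : S[X]) ^ p - C (f 0) with hF
  -- ### the torsor germ `S' = S[T]/(T^p − f 0)`
  haveI hloc' : IsLocalRing (AdjoinRoot F) := isLocalRing_adjoinRoot_X_pow_sub_C_of_charP p (f 0)
  have hmon : F.Monic := monic_X_pow_sub_C' p (f 0)
  haveI : Module.Finite S (AdjoinRoot F) := hmon.finite_adjoinRoot
  haveI : Module.Free S (AdjoinRoot F) := hmon.free_adjoinRoot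
  haveI : Algebra.IsIntegral S (AdjoinRoot F) := inferInstance
  haveI : IsNoetherianRing (AdjoinRoot F) := inferInstanceAs (IsNoetherianRing (S[X] ⧸ Ideal.span {F}))
  haveI : FaithfulSMul S (AdjoinRoot F) := inferInstance
  haveI : CharP (AdjoinRoot F) p := charP_of_injective_algebraMap' S p
  obtain ⟨c, hc1, hc2⟩ := exists_frobenius_approx p f g x hx hrel
  obtain ⟨k, hk⟩ := exists_pow_maximalIdeal_le p (f 0)
  obtain ⟨lam, hlam1, hlam0⟩ := exists_coord_root p (f 0)
  have hmaple := map_maximalIdeal_le p (f 0)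
  have hmappow : ∀ n, (maximalIdeal S ^ n).map (algebraMap S (AdjoinRoot F)) ≤ maximalIdeal (AdjoinRoot F) ^ n :=
    fun n => by rw [Ideal.map_pow]; exact Ideal.pow_right_mono hmaple n
  by_cases hred : IsReduced (AdjoinRoot F)
  · -- ### reduced case: the completion of the excellent reduced local ring `S'` is reduced …
    have hexc' : IsExcellentRing (AdjoinRoot F) := hexc.of_finiteType'
    have hR : IsReduced (AdicCompletion (maximalIdeal (AdjoinRoot F)) (AdjoinRoot F)) :=
      hexc'.isReduced_adicCompletion
    set I' : Ideal (AdjoinRoot F) := maximalIdeal (AdjoinRoot F) with hI'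
    -- … but `z = lim (T − c n)` is a non-zero nilpotent
    let e : ℕ → AdjoinRoot F := fun n => AdjoinRoot.root F - algebraMap S (AdjoinRoot F) (c n)
    have he : ∀ n, e n ≡ e (n + 1) [SMOD (I' ^ n • ⊤ : Submodule (AdjoinRoot F) (AdjoinRoot F))] := by
      intro n
      rw [SModEq.sub_mem, smul_eq_mul, Ideal.mul_top]
      have : e n - e (n + 1) = algebraMap S (AdjoinRoot F) (c (n + 1) - c n) := by
        simp only [e, map_sub]; ring
      rw [this]
      exact hmappow n (Ideal.mem_map_of_mem _ (hc1 n))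
    let E : AdicCompletion.AdicCauchySequence I' (AdjoinRoot F) :=
      AdicCompletion.AdicCauchySequence.mk I' (AdjoinRoot F) e he
    set z : AdicCompletion I' (AdjoinRoot F) := AdicCompletion.mkₐ I' E with hz_def
    have hzp : z ^ p = 0 := by
      refine AdicCompletion.ext_evalₐ fun n => ?_
      rw [map_pow, map_zero, hz_def, AdicCompletion.evalₐ_mkₐ, ← map_pow, Ideal.Quotient.eq_zero_iff_mem]
      show e n ^ p ∈ I' ^ n
      have : e n ^ p = algebraMap S (AdjoinRoot F) (f 0 - c n ^ p) := by
        show (AdjoinRoot.root F - algebraMap S (AdjoinRoot F) (c n)) ^ p = _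
        rw [sub_pow_char, ← map_pow, root_pow_eq, map_sub, AdjoinRoot.algebraMap_eq]
      rw [this]
      exact hmappow n (Ideal.mem_map_of_mem _ (hc2 n))
    have hz0 : z ≠ 0 := by
      intro hz
      have h1 := congrArg (AdicCompletion.evalₐ I' k) hz
      rw [map_zero, hz_def, AdicCompletion.evalₐ_mkₐ, Ideal.Quotient.eq_zero_iff_mem] at h1
      have h2 : e k ∈ (maximalIdeal S) • (⊤ : Submodule S (AdjoinRoot F)) := by
        rw [Ideal.smul_top_eq_map]
        exact hk h1
      have h3 : lam (e k) ∈ maximalIdeal S := by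
        have h4 : ((maximalIdeal S) • (⊤ : Submodule S (AdjoinRoot F))).map lam ≤
            (maximalIdeal S : Submodule S S) := by
          rw [Submodule.map_smul'', Ideal.smul_eq_mul]
          exact Ideal.mul_le_right
        exact h4 (Submodule.mem_map_of_mem h2)
      have h5 : lam (e k) = 1 := by
        show lam (AdjoinRoot.root F - algebraMap S (AdjoinRoot F) (c k)) = 1
        rw [map_sub, hlam1, AdjoinRoot.algebraMap_eq, hlam0, sub_zero]
      rw [h5] at h3
      exact (maximalIdeal.isMaximal S).ne_top (Ideal.eq_top_of_isUnit_mem _ h3 isUnit_one)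
    exact hz0 (hR.eq_zero z ⟨p, hzp⟩)
  · -- ### non-reduced case: a non-zero nilpotent `w` survives at a non-maximal prime `P ⊇ Ann(w)`
    rw [isReduced_iff, not_forall] at hred
    obtain ⟨w, hw⟩ := hred
    rw [Classical.not_imp] at hw
    obtain ⟨hwnil, hw0⟩ := hw
    set J : Ideal (AdjoinRoot F) := (Submodule.span (AdjoinRoot F) {w}).annihilator with hJ_def
    have hJ : ∀ s, s ∈ J ↔ s * w = 0 := fun s => by
      rw [hJ_def, Submodule.mem_annihilator_span_singleton, smul_eq_mul]
    have hP : ∃ P : Ideal (AdjoinRoot F), P.IsPrime ∧ J ≤ P ∧ P ≠ maximalIdeal (AdjoinRoot F) := by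
      by_contra hcon
      have hrad : maximalIdeal (AdjoinRoot F) ≤ J.radical := by
        rw [Ideal.radical_eq_sInf]
        refine le_sInf ?_
        rintro Q ⟨hJQ, hQ⟩
        by_cases hQe : Q = maximalIdeal (AdjoinRoot F)
        · exact hQe.symm.le
        · exact absurd ⟨Q, hQ, hJQ, hQe⟩ hcon
      obtain ⟨y, hy, hy0⟩ := Submodule.exists_mem_ne_zero_of_ne_bot hS
      obtain ⟨N, hN⟩ := hrad (hmaple (Ideal.mem_map_of_mem _ hy))
      have hyw : (y ^ N) • w = 0 := by
        rw [Algebra.smul_def, map_pow]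
        exact (hJ _).mp hN
      exact hw0 ((smul_eq_zero.mp hyw).resolve_left (pow_ne_zero N hy0))
    obtain ⟨P, hPp, hJP, hPne⟩ := hP
    haveI := hPp
    have hlt : P < maximalIdeal (AdjoinRoot F) :=
      lt_of_le_of_ne (IsLocalRing.le_maximalIdeal hPp.ne_top) hPne
    haveI := hisol P ⟨maximalIdeal (AdjoinRoot F), inferInstance, hlt⟩
    haveI : IsDomain (Localization.AtPrime P) := isDomain_of_isRegularLocalRing _
    have h0 : algebraMap (AdjoinRoot F) (Localization.AtPrime P) w = 0 :=
      (hwnil.map (algebraMap (AdjoinRoot F) (Localization.AtPrime P))).eq_zero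
    rw [IsLocalization.map_eq_zero_iff P.primeCompl] at h0
    obtain ⟨⟨s, hs⟩, hsw⟩ := h0
    exact hs (hJP ((hJ s).mpr hsw))

end Core

end NoEternalChainOne

end Summit.ResolutionOfSingularities.ResolutionOfSingularities.Theorems.SwitchingDichotomy

end
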